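/-
Origin: expansion seat `planner-pub-hodgecm-pv13-g3-0`, handover #4 2026-08-18T06:59:41Z (`HOME/pub-hodgecm-pv13-g3/lean/Pv13g3/SplitHaarAdic.lean`, md5 5726cbc0, 164 lines);
landed by the gen-7 packager in gate run 25 as `HodgeCM/PerL34/SplitHaarAdic.lean` (import ^import Pv07g2\.→import HodgeCM.PerL34.LocalFactors. ×1; import ^import Pv13g3\.→import HodgeCM.PerL34. ×1).
-/
/-
Copyright: HodgeCM publication cell (pub-hodgecm), DAG node N31h (θ_χ(f_χ) ≠ 0) — seam S3, split side, END FORM AT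
THE GENUINE COMPLETIONS `L_{0,v}` (prover pv13, gen 3; consumer of pv07-g2's `LocalFactors.AdicSplitFactor`).
Released under the package licence.

# `θ ≠ 0` with the split unramified places modelled on `F_v := L_{0,v} = (w v).adicCompletion L₀` — `q_v = N(v)` DISCHARGED

`SplitHaar.lean` (this seat, handover #3) ended the split side of seam S3 in
`SplitShells.theta_ne_zero_levels_of_dilation`: `θ ≠ 0` from canonical Haar data, a compact fundamental
domain, levels, LOCAL continuity, and — per split unramified place `v ∉ S` — the place valuation with its
kernel and uniformizer, the invariances `fixed`/`unram`, `ν_v` unramified, `vol = 1`, the ONE dictionary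
identification `coeff_eq`, over an ABSTRACT family of non-archimedean local fields `F_v` with elements
`ϖF_v`, `‖ϖF_v‖ < 1`, under the displayed BOOKKEEPING hypothesis `hq : [𝒪_v : ϖF_v 𝒪_v] = N(v)`.
pv07-g2's `LocalFactors.AdicSplitFactor` (handover #8, run 25) proves, for `F_v := K_v = v.adicCompletion K`
(`K` a number field, `v` a finite place) and every norm-uniformizer `ϖ` (`DilationModel.IsUniformizer ϖ`):
`Adic.resIndex_eq_absNorm : LocalModulus.resIndex ϖ = Ideal.absNorm v.asIdeal`, i.e. `[𝒪_v : ϖ𝒪_v] = N(v)`,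
with `K_v` non-trivially normed (Mathlib's structure) and proper (vendored cone), and the canonical additive
Haar measure `Adic.muV` on `K_v³` with `vol(𝒪_v³) = 1`.

THIS FILE is the consumer: the end theorem AT THE INTENDED OBJECTS.
* `theta_ne_zero_levels_adic` — `theta_ne_zero_levels_of_dilation` with `F_v := (w v).adicCompletion L₀`
  for a place map `w : ι → (finite places of L₀)` injective off `S`, and `ϖF_v` a uniformizer of `L_{0,v}`:
  the hypotheses `hϖF : ‖ϖF_v‖ < 1` and **`hq : resIndex ϖF_v = N(v)` are GONE** (theorems:
  `IsUniformizer.1`, `Adic.resIndex_eq_absNorm`); `q_v` no longer occurs — it IS `N(w v)`, KERNEL.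
* `theta_ne_zero_levels_adic_canonical` — moreover `dx_v := Adic.muV` (Haar on `L_{0,v}³` normalised by
  `vol(𝒪_v³) = 1`, tex l. 631 "measures giving the maximal compact subgroups volume 1") and `ρ_v = 1`:
  the hypothesis **`hvol` is GONE** too (`Adic.muV_real_closedBall`).
After this file the per-place input at a split unramified place `v ∉ S` is EXACTLY: `ord_v` with kernel `B_v`
and `ord_v(ϖ_v) = 1`; `fixed` / `unram` (tex l. 628 "φ_v = φ_v⁰ and all splitting data are unramified");
`ν_v` unramified; a uniformizer `ϖF_v ∈ L_{0,v}`; and the ONE dictionary identification `coeff_eq`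
(tex l. 610–611: the matrix coefficient of `ω_χ` at `ϖ_v^n` against `φ⁰_v` IS the `L_{0,v}³`-Schrödinger /
dilation coefficient) — the DICT residual of GAPS pv13g3-A2/A3, unchanged and explicit.

Source under adjudication (NOT cited; these are the lines whose split-place content is now kernel down to
`coeff_eq`): PerL v5 = `inputs/2001/summits__hodge-w-picard-modular-quadrilinear-period-galois-closure__free__y1__paper__paper.tex`
(= `…__work__paper-v5-d912a121.tex`, 738 l.), Lemma 4.2(b) proof, VERBATIM —
  l. 628: "(b) Let $S\ni\infty$ be finite with $\phi_v=\phi^0_v$ and all splitting data unramified for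
           $v\notin S$; …"
  l. 629–631: "… $I_v(\phi_v):=\int_{L_{0,v}^\times}\langle\omega_{\chi,v}(\iota_T(y))\phi_v,\phi_v\rangle\,
           \chi'_{i,v}(y)\,d^\times y$, … resp.\ $I_v(\phi^0_v)=\sum_{n\in\Z}q_v^{-3|n|/2}a_v^{n}
           =(1-q_v^{-3})\,|1-a_vq_v^{-3/2}|^{-2}$ at split $v$, with $a_v=\nu_v\chi'_{i,v}(\varpi_v)$,
           $|a_v|=1$ (measures giving the maximal compact subgroups volume $1$)."
Nothing is cited; no hypothesis names PerL, QW8 or a 2001-programme claim.  Axioms = the standard trio.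
Unit `pub-hodgecm-pv13-g3` (DAG-node prover #13, generation 3), 2026-08-18.

Imports: `Pv13g3.SplitHaar` ↦ `HodgeCM.PerL34.SplitHaar` (this seat, handover #3, run 25) and
`Pv07g2.AdicSplitFactor` ↦ `HodgeCM.PerL34.LocalFactors.AdicSplitFactor` (pv07-g2, handover #8, run 25).
-/
import Summits.HodgeConjecture.HodgeCM.PerL34.SplitHaar
import Summits.HodgeConjecture.HodgeCM.PerL34.LocalFactors.AdicSplitFactor

set_option autoImplicit false

noncomputable section

open MeasureTheory MeasureTheory.Measure Set Metric Function Complex ComplexConjugate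

open scoped RestrictedProduct InnerProductSpace NNReal

namespace HodgeCM.PerL34.SplitShells

open HodgeCM.PerL34.PureTensor HodgeCM.PerL34.AdelicFactorisation HodgeCM.PerL34.RestrictedMeasure
open HodgeCM.PerL34.NoSmallSubgroups
open HodgeCM.PerL34.LocalFactors HodgeCM.PerL34.LocalFactors.DilationModel

/-! `L_{0,v}` is used with Mathlib's normed-field structure made NON-TRIVIALLY normed
(`Adic.nontriviallyNormedField = Valued.toNontriviallyNormedField`, `rfl` over Mathlib's instance) and with
`ProperSpace` from the vendored cone (`Adic.properSpace`) — pv07-g2's file-local instances, re-activated here. -/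
attribute [local instance] LocalFactors.DilationModel.Adic.nontriviallyNormedField
  LocalFactors.DilationModel.Adic.properSpace

section adicEnd

variable {ι : Type} {G : ι → Type} [∀ i, CommGroup (G i)] [∀ i, TopologicalSpace (G i)]
  [∀ i, IsTopologicalGroup (G i)] [∀ i, T2Space (G i)] [∀ i, SecondCountableTopology (G i)]
  [∀ i, LocallyCompactSpace (G i)] [∀ i, MeasurableSpace (G i)] [∀ i, BorelSpace (G i)]
  [Countable ι] [DecidableEq ι]
  (B : ∀ i, Subgroup (G i)) (hBc : ∀ i, IsCompact (B i : Set (G i)))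
  (hBo : ∀ i, IsOpen (B i : Set (G i))) (S₀ : Finset ι)
  {Sp : Type} [NormedAddCommGroup Sp] [InnerProductSpace ℂ Sp]
  {E : Type*} [NormedAddCommGroup E] [InnerProductSpace ℂ E]
  (ω : (Πʳ j, [G j, B j]) →* (Sp ≃ₗᵢ[ℂ] Sp)) (φ : Sp) (hφ : ‖φ‖ = 1)
  (hloc : ∀ (i : ι) (v : Sp), Continuous fun g : G i => ω (RestrictedProduct.mulSingle B i g) v)
  (χ : (Πʳ j, [G j, B j]) →* Circle) {T' : Finset ι}
  (hχT' : RestrictedProduct.boxSubgroup B T' ≤ χ.ker)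
  (hlocχ : ∀ i ∈ T', Continuous fun g : G i => χ (RestrictedProduct.mulSingle B i g))
  (𝓕 : Set (Πʳ j, [G j, B j])) (h𝓕c : IsCompact 𝓕) (h𝓕i : (interior 𝓕).Nonempty)
  (K : (Πʳ j, [G j, B j]) → (Πʳ j, [G j, B j]) → ℂ) (c : ℝ) (c_pos : 0 < c) (θ : E) (Θ : Set E)
  (hθ : θ ∈ Θ)
  (hN31e : RallisIP.N31e_statement (haarDatum B hBc hBo S₀).μ 𝓕 ω φ
    (fun y => ((χ y : Circle) : ℂ)) K (c : ℂ))
  (hnorm : ⟪θ, θ⟫_ℂ = ∫ u in 𝓕, ∫ u' in 𝓕, ((χ u : Circle) : ℂ) * conj ((χ u' : Circle) : ℂ) *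
    K u u' ∂(haarDatum B hBc hBo S₀).μ ∂(haarDatum B hBc hBo S₀).μ)
  {T : Finset ι} (hK : ∀ k ∈ RestrictedProduct.boxSubgroup B T, ω k φ = φ)
  (hM : ∀ S : Finset ι, T ⊆ S → ∀ y : (i : ↥S) → G i,
    inner ℂ φ (ω (extendOne B S y) φ) = ∏ i : ↥S, localCoeff B ω φ i (y i))
  {S : Finset ι} {IsSplit : ι → Prop}
  (hBi : ∀ i, i ∉ S → ¬IsSplit i → (B i : Set (G i)) = Set.univ)
  (hν1 : ∀ i, i ∉ S → ¬IsSplit i → (haarDatum B hBc hBo S₀).ν i Set.univ = 1)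
  (hTS : T ⊆ S) (hT'S : T' ⊆ S)
  (hclS : ∀ i ∈ S, Integrable (localCoeff B ω φ i) ((haarDatum B hBc hBo S₀).ν i))
  (ram_pos : ∀ i ∈ S, 0 < (localIntegrand B (haarDatum B hBc hBo S₀) ω φ χ i).I)
  /- the totally real field `L₀` and the place map: index `i` ↦ the finite place `w i` of `L₀`
     (injective OFF `S`; what `w` does on `S` is immaterial) -/
  (L₀ : Type) [Field L₀] [NumberField L₀]
  (w : ι → IsDedekindDomain.HeightOneSpectrum (NumberField.RingOfIntegers L₀))
  (hw : ∀ ⦃i j : ι⦄, i ∉ S → j ∉ S → w i = w j → i = j)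

include hφ hloc hχT' hlocχ h𝓕c h𝓕i c_pos hθ hN31e hnorm hK hM hBi hν1 hTS hT'S hclS ram_pos hw

/-- **`θ ≠ 0`, split places from the dilation model ON THE COMPLETIONS `L_{0,v} = (w v).adicCompletion L₀`.**
`SplitShells.theta_ne_zero_levels_of_dilation` with `F_v := L_{0,v}` and `ϖF_v` a uniformizer of `L_{0,v}`:
its hypotheses `‖ϖF_v‖ < 1` and `hq : [𝒪_v : ϖF_v𝒪_v] = N(v)` are DISCHARGED (`IsUniformizer`,
pv07-g2 `Adic.resIndex_eq_absNorm`).  `q_v` does not occur: it is `N(w v)`, kernel. -/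
theorem theta_ne_zero_levels_adic
    [∀ i, MeasurableSpace (Fin 3 → (w i).adicCompletion L₀)]
    [∀ i, BorelSpace (Fin 3 → (w i).adicCompletion L₀)]
    (μV : ∀ i, Measure (Fin 3 → (w i).adicCompletion L₀)) [∀ i, (μV i).IsAddHaarMeasure] (ρ : ι → ℝ)
    (ν : ∀ i, ((w i).adicCompletion L₀)ˣ →* Circle) (ord : ∀ i, G i →* Multiplicative ℤ) (ϖ : ∀ i, G i)
    (ϖF : ∀ i, ((w i).adicCompletion L₀)ˣ) (hϖF : ∀ i, i ∉ S → IsUniformizer (ϖF i))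
    (ord_ϖ : ∀ i, i ∉ S → IsSplit i → ord i (ϖ i) = Multiplicative.ofAdd 1)
    (ker_ord : ∀ i, i ∉ S → IsSplit i → ∀ g : G i, ord i g = 1 ↔ g ∈ B i)
    (fixed : ∀ i, i ∉ S → IsSplit i → ∀ b : G i, b ∈ B i → ω (RestrictedProduct.mulSingle B i b) φ = φ)
    (unram : ∀ i, i ∉ S → IsSplit i → ∀ b : G i, b ∈ B i → χ (RestrictedProduct.mulSingle B i b) = 1)
    (hν : ∀ i, i ∉ S → IsSplit i → ∀ u : ((w i).adicCompletion L₀)ˣ,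
      ‖(u : (w i).adicCompletion L₀)‖ = 1 → ν i u = 1)
    (hvol : ∀ i, i ∉ S → IsSplit i →
      (μV i).real (closedBall (0 : Fin 3 → (w i).adicCompletion L₀) (ρ i)) = 1)
    (coeff_eq : ∀ i, i ∉ S → IsSplit i → ∀ n : ℤ, localCoeff B ω φ i (ϖ i ^ n)
      = ⟪ballIndicator (μV i) 0 (ρ i), dilationRep (μV i) (ν i) (ϖF i ^ n) (ballIndicator (μV i) 0 (ρ i))⟫_ℂ) :
    θ ≠ 0 :=
  theta_ne_zero_levels_of_dilation B hBc hBo S₀ ω φ hφ hloc χ hχT' hlocχ 𝓕 h𝓕c h𝓕i K c c_pos θ Θ hθ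
    hN31e hnorm hK hM hBi hν1 hTS hT'S hclS ram_pos L₀ (fun j => w j.1)
    (fun j j' h => Subtype.ext (hw j.2 j'.2 h)) (fun i => (w i).adicCompletion L₀) μV ρ ν ord ϖ ϖF
    ord_ϖ ker_ord fixed unram hν hvol coeff_eq (fun i hi => (hϖF i hi).1)
    (fun j => Adic.resIndex_eq_absNorm L₀ (w j.1) (ϖF j.1) (hϖF j.1 j.2))

/-- **Same, with the CANONICAL volume**: `dx_v := Adic.muV` = the additive Haar measure of `L_{0,v}³` with
`vol(𝒪_v³) = 1` (tex l. 631) and `ρ_v = 1`, so `φ⁰_v = 1_{𝒪_v³}`: the hypothesis `hvol` is DISCHARGED too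
(pv07-g2 `Adic.muV_real_closedBall`).  The σ-algebra on `L_{0,v}` is a binder (Borel; inhabited,
`Adic.borel_exists`). -/
theorem theta_ne_zero_levels_adic_canonical
    [∀ i, MeasurableSpace ((w i).adicCompletion L₀)] [∀ i, BorelSpace ((w i).adicCompletion L₀)]
    (ν : ∀ i, ((w i).adicCompletion L₀)ˣ →* Circle) (ord : ∀ i, G i →* Multiplicative ℤ) (ϖ : ∀ i, G i)
    (ϖF : ∀ i, ((w i).adicCompletion L₀)ˣ) (hϖF : ∀ i, i ∉ S → IsUniformizer (ϖF i))
    (ord_ϖ : ∀ i, i ∉ S → IsSplit i → ord i (ϖ i) = Multiplicative.ofAdd 1)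
    (ker_ord : ∀ i, i ∉ S → IsSplit i → ∀ g : G i, ord i g = 1 ↔ g ∈ B i)
    (fixed : ∀ i, i ∉ S → IsSplit i → ∀ b : G i, b ∈ B i → ω (RestrictedProduct.mulSingle B i b) φ = φ)
    (unram : ∀ i, i ∉ S → IsSplit i → ∀ b : G i, b ∈ B i → χ (RestrictedProduct.mulSingle B i b) = 1)
    (hν : ∀ i, i ∉ S → IsSplit i → ∀ u : ((w i).adicCompletion L₀)ˣ,
      ‖(u : (w i).adicCompletion L₀)‖ = 1 → ν i u = 1)
    (coeff_eq : ∀ i, i ∉ S → IsSplit i → ∀ n : ℤ, localCoeff B ω φ i (ϖ i ^ n)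
      = ⟪ballIndicator (Adic.muV L₀ (w i)) 0 1,
          dilationRep (Adic.muV L₀ (w i)) (ν i) (ϖF i ^ n) (ballIndicator (Adic.muV L₀ (w i)) 0 1)⟫_ℂ) :
    θ ≠ 0 :=
  theta_ne_zero_levels_adic B hBc hBo S₀ ω φ hφ hloc χ hχT' hlocχ 𝓕 h𝓕c h𝓕i K c c_pos θ Θ hθ hN31e
    hnorm hK hM hBi hν1 hTS hT'S hclS ram_pos L₀ w hw (fun i => Adic.muV L₀ (w i)) (fun _ => 1) ν ord ϖ
    ϖF hϖF ord_ϖ ker_ord fixed unram hν (fun i _ _ => Adic.muV_real_closedBall L₀ (w i)) coeff_eq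

end adicEnd

end HodgeCM.PerL34.SplitShells

end
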